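import Literature.NumberTheory.Automorphic.ResGLnConeDictionary
import HarnessLib

/-!
# Rank zero: every positive-degree cochain of `C^•(𝔤𝔩₀(K_∞), K_∞; W ⊗ E_λ)` vanishes

Topic `NumberTheory/Automorphic`; namespace `Literature.NumberTheory.Automorphic.ConeDictionary`.
Theorems only; no definition, no named fact, no `sorry`.

The corner `n = 0` of Borel's injectivity of cuspidal cohomology (`ResGLnCuspidalCohomologyApex`,
fact `Borel1983_coneClass_ne_zero`, whose remaining analytic input is needed only for `n ≠ 0`,
`ResGLnKugaPairedPrimitive.false_of_horizontal_pairedPrimitive`): the Lie algebra `𝔤𝔩₀(K_∞)` is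
zero, so an alternating `(q+1)`-cochain on it vanishes (`cochain_eq_zero_of_rank_zero`) and in
particular lies in the coboundaries (`mem_coboundaries_of_rank_zero`) — the hypothesis `η ∉ B` of
the fact is never satisfied for `n = 0`. [folklore]

## References

* A. Borel, N. Wallach (2000), I §1.1 (cochains). [BorelWallach2000]
-/

noncomputable section

namespace Literature.NumberTheory.Automorphic

-- Mathlib idiom (as in `GKModules`): commutator bracket on matrix algebras and `Module.End`
attribute [local instance 100] LieRing.ofAssociativeRing

open scoped TensorProduct Classical _root_.Matrix
open _root_.NumberField _root_.NumberField.InfinitePlace _root_.NumberField.mixedEmbedding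
open Literature.Algebra.Lie.ChevalleyEilenberg

namespace ConeDictionary

variable {K : Type} [Field K] [NumberField K] {hcpt : isCompact_glFiniteIntegralLevel 0 K}
  (π : AutomorphicRepData (AutomorphyDatum.gl 0 K hcpt))
  (S : Finset {w : InfinitePlace K // w.IsReal}) (lam : (K →+* ℂ) → Fin 0 → ℤ)

/-- `𝔤𝔩₀(K_∞) = 0`: the Lie algebra of the rank-zero datum is a subsingleton. [folklore] -/
theorem subsingleton_lie_rank_zero : Subsingleton (AutomorphyDatum.gl 0 K hcpt).arch.lie :=
  ⟨fun _ _ => Subtype.ext (Matrix.ext fun i _ => Fin.elim0 i)⟩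

/-- **Every cochain of positive degree on `𝔤𝔩₀(K_∞)` vanishes** (it is alternating multilinear in
`q + 1 ≥ 1` arguments from the zero Lie algebra). [folklore] -/
theorem cochain_eq_zero_of_rank_zero (q : ℕ) (η : Cochain π lam (q + 1)) : η = 0 := by
  haveI := subsingleton_lie_rank_zero (K := K) (hcpt := hcpt)
  refine AlternatingMap.ext fun X => ?_
  rw [AlternatingMap.zero_apply]
  exact η.map_coord_zero 0 (Subsingleton.elim _ _)

/-- Hence every such cochain is a coboundary of `gkComplexLS π S λ`: the hypothesis `η ∉ B^{q+1}`
of `Borel1983_coneClass_ne_zero` is void for `n = 0`. [folklore] -/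
theorem mem_coboundaries_of_rank_zero (q : ℕ) (η : Cochain π lam (q + 1)) :
    η ∈ (gkComplexLS π S lam).coboundaries (q + 1) := by
  rw [cochain_eq_zero_of_rank_zero π lam q η]
  exact Submodule.zero_mem _

end ConeDictionary

end Literature.NumberTheory.Automorphic

end
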